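import Literature.MathematicalPhysics.QuantumFieldTheory.Balaban1983to89.UnitaryModel
import Literature.MathematicalPhysics.QuantumFieldTheory.Balaban1983to89.B14Eq18Concrete
import Literature.MathematicalPhysics.QuantumFieldTheory.Balaban1983to89.B14Eq316
import Literature.MathematicalPhysics.QuantumFieldTheory.Balaban1983to89.B14Eq119SecondFunction

/-!
# `Balaban1983to89.B14Eq118Concrete` — CMP 119 (1.18)–(1.19) p. 250, the small/large FLUCTUATION-field decomposition of
# unity of the first step and the product (1.19), PROVED for the concrete characteristic functions: (1.18) IS (3.16) at
# the first step (r11's `B14.Eq316.chiK`/`chiKc`/`eq316` with the starred bond sets `(□′^{∼2})*` and the threshold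
# `g₀⁻¹δ₀`), the second function of (1.19) IS the (1.8)-function of `□′` at the translated field `U = e^{ig₀A}U₁`, and
# «Thus the second function in the product (1.19) is equal to 1, and we can omit it. These functions remain only for
# □′ ⊂ (Ω₁∖Ω₁^{∼−1}) ∪ R₁» PROVED (gen 3's `B14.Eq119SecondFunction.secondFunction_eq_one` by name + cube bookkeeping)

statement-level skeleton of published theorems with citation tags; proofs where landed; nothing here is a claim about the Yang–Mills mass gap

CITATION HEADER (lean-in-tree rule).  Source: T. Bałaban, *Convergent renormalization expansions for lattice gauge
theories*, Commun. Math. Phys. **119**, 243–285 (1988), doi:10.1007/bf01217741 [Balaban1988Convergent] (cell paper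
B14 = «[III]»; held `paper:balaban1988-cmp119-convergent-renormalization`, journal page = PDF page + 242; p. 250 READ AS AN
IMAGE on the x2 render `…-p008-x2.png` of `run/shared/lean/pub/pub-balaban/b2b-balaban-ref1/pages/1988-cmp119-convergent-
renormalization/`, the text layer `p0008` being unreliable on displays).  Mega-formalization `lit-balaban`, unit
`lit-balaban-r11` (CMP 119, B14 fold owner), SKELETON row **B14.Eq1.18–1.19** (row B14.Eq3.16 = (3.16), the step-k twin,
`proved`; row B14.Eq1.8 = (1.8); row B14.Eq1.9 = the starred set `X*`; row B14.Eq1.17 = the invariance (1.17), whose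
«invariance aspect» of the A-only functions is `T4AdjointCovariance*` and is NOT this file's business).

THE PRINTED TEXT (p. 250 [PDF 8], verbatim).  *"To get this invariance for the last integral in (1.16) we have to replace
the characteristic function χ₀′(Ω₁) by functions depending on A only. We introduce a new decomposition of unity in the
domain Ω₁^{∼−1} = ((Ω₁ᶜ)^∼)ᶜ:
  1 = Σ_{R₁} Π_{□′⊂R₁ᶜ} χ({sup_{b∈(□′^{∼2})*} |A(b)| < g₀⁻¹δ₀}) · Π_{□′⊂R₁} χ({sup_{b∈(□′^{∼2})*} |A(b)| ≧ g₀⁻¹δ₀})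
    = Σ_{R₁} χ^{(0)}(R₁ᶜ) χ^{(0)c}(R₁).   (1.18)
Here the summation is over sets R₁ ⊂ Ω₁^{∼−1}, which are unions of L²M₂R₁-cubes, and R₁ᶜ means the complement to
Ω₁^{∼−1}. Consider a cube □′ ⊂ R₁ᶜ. For this cube we now have the product of the two characteristic functions,
  χ({sup_{b∈(□′^{∼2})*} |A(b)| < g₀⁻¹δ₀}) · χ({sup_{b∈(□′^{∼2})*} |exp ig₀A(b) U₁(b) U_{1,□′}⁻¹(b) − 1| < 2δ₀}).   (1.19)
The cube □′^{∼4} is contained in Ω₁, and both configurations U₁, U_{1,□′} are determined by the same configuration V on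
□′^{∼3}, hence on □′^{∼2} the difference between these configurations is very small. More precisely |U₁U_{1,□′}⁻¹ − 1| <
O(1)B₃·exp(−δLM₂R₁)ε₁, and the bound can be made much smaller than δ₀, if M₂R₁ is large enough. Thus the second function
in the product (1.19) is equal to 1, and we can omit it. These functions remain only for □′ ⊂ (Ω₁∖Ω₁^{∼−1}) ∪ R₁, more
precisely they are the only functions for □′ ⊂ Ω₁∖Ω₁^{∼−1}, and for □′ ⊂ R₁ they are multiplied by the corresponding
large field characteristic function in (1.18)."*  (U₁ = U₁(Ω₁, V), the configuration of (1.12) p. 248; U_{1,□′} = (1.2)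
p. 246; A the fluctuation field of (1.13)–(1.15), 𝐠-valued; the functions «we now have» are the (1.8)-functions
χ({sup_{b∈(□′^{∼2})*}|U(b)U_{1,□′}⁻¹(b) − 1| < 2δ₀}) kept on Ω₁ (p. 248), read after the translation U = U′U₁ (p. 248),
U′ = exp iA′ (1.13) and the scaling of p. 249.)

THE CARRIERS (all pre-existing, knitted BY NAME; NO definition is introduced here).
* The first-step data `D : B14.Sect3Decomp.Sect3Data P G 0` (gen 2): the L²M₂R₁-cubes `□′` (`D.Cube1`), their starred bond
  sets `D.bondsStar □′ = (□′^{∼2})*` on the unit lattice ((1.9), row B14.Eq1.9 — a cell-wide datum, lead HEAD WORD Q-B14-96-1),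
  and the localized background `D.UkLoc □′ = U_{1,□′}(·)`; print's instance is r11's `B14.Eq216Concrete.sect3Of bg M₁ D enl4`,
  whose `UkLoc □′ V` IS the concrete (1.2) = (2.16) at scale 1, `ukBox bg M₁ (□′^{∼4}) 1 V` (`ukLoc_sect3Of`, `rfl`) — the
  same instance on which (1.8) is `B14.Eq18Concrete.eq18_concrete`.
* (1.18): the fluctuation field `A : PBond P 0 → 𝔸` with values in a (semi)normed group (`|·| = ‖·‖`); its functions
  χ^{(0)}, χ^{(0)c} ARE r11's (3.16)-functions `B14.Eq316.chiK D.bondsStar A (g₀⁻¹δ₀)` / `chiKc …` (bodies: products over the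
  cubes of the `0/1` functions of `SmallFluct D.bondsStar A (g₀⁻¹δ₀) □′ : ∀ b ∈ (□′^{∼2})*, ‖A b‖ < g₀⁻¹δ₀`), i.e. (3.16)
  p. 268 read at the first step with print's threshold `g₀⁻¹δ₀` on the unscaled field — exactly as (1.8) is (3.3) at `k = 0`.
* (1.19): the operator-norm model of gen 3's `B14.Eq119SecondFunction` — a C⋆-algebra `𝔸` (print: `G ⊂ U(N) ⊂ M_N(ℂ)` with
  the operator norm, [Balaban1985Averaging] (19)), the fluctuation field self-adjoint-valued, `A : PBond P 0 → selfAdjoint 𝔸`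
  (print's `exp ig₀A(b)` = `selfAdjoint.expUnitary (g₀ • A b)`), and the gauge group `G` (`Setup.GaugeGroup`, abstract as in
  the whole cell) REALISED in `𝔸` by a monoid homomorphism `ρ : G →* 𝔸`; where a statement compares the two readings of
  `|· − 1|` the realisation hypothesis `hρ : ‖ρ g − 1‖ = dist1 g` is explicit (it is the DEFINITION of `dist1` for the
  tree's matrix groups, `UnitaryModel.GaugeGroup.ofUnitaryRep_dist1`).  The second function of (1.19) IS gen 3's
  `secondFunction (D.bondsStar □′) (b ↦ exp(ig₀A(b))·ρ(U₁(b)U_{1,□′}(V)(b)⁻¹)) δ₀`, the first is `chiK … {□′}`.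

WHAT IS PROVED (theorems only; 0 definitions, 0 `sorry`, axioms standard).
§1 **(1.18)** `eq118_concrete` — `Σ_{R₁⊂Ω₁^{∼−1}} χ^{(0)}(R₁ᶜ)χ^{(0)c}(R₁) = 1`, the sum over all sub-families `R₁` of the cube
   family `inner` of `Ω₁^{∼−1}`, `R₁ᶜ = inner ∖ R₁` («the complement to Ω₁^{∼−1}») := `B14.Eq316.eq316` at the first step;
   `eq118_term_eq_one_iff` (the single non-zero term: `R₁` = the large-fluctuation cubes); `smallFluct_first_iff` (the cube
   condition verbatim) and `smallFluct_first_iff_scaled` (for `g₀ > 0`: `|A(b)| < g₀⁻¹δ₀ ⇔ ‖g₀A(b)‖ < δ₀`, the support of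
   (1.19)₁ in the form gen 3's theorem consumes); `chiK_singleton` ((1.19)₁ = `χ^{(0)}({□′})`) and `chiK_eq_prod_singleton`
   (the printed product form `χ^{(0)}(X) = Π_{□′⊂X} χ(…)`).
§2 **(1.19)**: `second119_eq_chiPrime` — PROVENANCE: the second function of (1.19) IS the (1.8)-function `χ₀′` of the cube
   `□′` (gen 2's `B14.Sect3Decomp.chiPrime D av (2δ₀) {□′}` at `k = 0`, `V^{(0)}_{□′} = U_{1,□′}`) evaluated at the
   translated field `U(b) = e(b)U₁(b)` whenever `ρ(e(b)) = exp ig₀A(b)` (print: `A` is 𝐠-valued, so `exp ig₀A(b) ∈ G`) and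
   `hρ`; `second119_eq_one` — **«Thus the second function in the product (1.19) is equal to 1»**: on the support of the
   first function (`sup_{(□′^{∼2})*}|A| < g₀⁻¹δ₀`, `g₀ > 0`) and under print's bound in the located form
   `‖ρ(U₁(b)U_{1,□′}(b)⁻¹) − 1‖ ≤ ε ≤ δ₀/2`, `δ₀ ≤ 1` («much smaller than δ₀») := gen 3's `secondFunction_eq_one` with
   `x b := g₀ • A b`; `second119_eq_one_of_dist1` (the same with the bound stated on `dist1 (U₁(b)U_{1,□′}(b)⁻¹)` and `hρ`);
   `prod119_eq_first` — **«and we can omit it»**: the product (1.19) equals its first factor (no support hypothesis: off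
   the support both sides vanish); `second119_eq_one_concrete` — the same AT PRINT'S INSTANCE `sect3Of bg M₁ D enl4`,
   `U_{1,□′}(V) = ukBox bg M₁ (□′^{∼4}) 1 V` explicit.
§3 **«These functions remain only for □′ ⊂ (Ω₁∖Ω₁^{∼−1}) ∪ R₁, more precisely they are the only functions for
   □′ ⊂ Ω₁∖Ω₁^{∼−1}, and for □′ ⊂ R₁ they are multiplied by the corresponding large field characteristic function in
   (1.18)»**: `eq119_remaining` — for cube families `inner ⊆ omega` (the cubes of `Ω₁^{∼−1} ⊆ Ω₁`), inserting (1.18) under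
   the product `Π_{□′⊂Ω₁}` of the second functions and omitting them on `R₁ᶜ`:
   `Π_{□′∈omega} S(□′) = Σ_{R₁⊆inner} χ^{(0)}(inner∖R₁)·χ^{(0)c}(R₁)·(Π_{□′∈R₁} S(□′))·(Π_{□′∈omega∖inner} S(□′))`, PROVED from
   §2 and `Finset` algebra (the further split of `χ^{(0)}(R₁ᶜ)` along `Λ₁` is (1.25), row B14.Eq1.23–1.25, p28's
   `B14Eq124Jacobians.eq125_resummation`, whose hypothesis «a □ = 1 → c □ = 1» is exactly `prod119_eq_first`).
§4 **PRINT'S INSTANCE `G = U(n) ⊂ M_n(ℂ)`** (operator norm, [Balaban1985Averaging] (19); the tree's `UnitaryModel`: `dist1 U =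
   ‖U − 1‖` by definition): the realisation hypotheses of §2 DISCHARGED — `realisation_unitaryGroup` (`ρ` = the inclusion
   `U(n) ↪ M_n(ℂ)` satisfies `‖ρU − 1‖ = dist1 U`, and `e := exp ig₀A ∈ U(n)` is a lift, both `rfl`), hence
   `second119_eq_chiPrime_unitaryGroup` (the provenance identity with NO hypothesis: at `G = U(n)` the second function of
   (1.19) IS the (1.8)-function at `U = e^{ig₀A}U₁`) and `second119_eq_one_unitaryGroup`.  The C⋆-algebra structure of
   `M_n(ℂ)` for the operator norm is assembled IN THE STATEMENTS from Mathlib's scoped `Matrix.Norms.L2Operator` instances by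
   `CStarAlgebra.mk` (`letI`); no global instance is declared (lean/CONVENTIONS §4).
«and the bound can be made much smaller than δ₀, if M₂R₁ is large enough» is gen 3's `small_if_M2R1_large` (explicit
threshold), not repeated.

WHAT IS *NOT* PROVED OR ASSERTED HERE.  The bound `|U₁U_{1,□′}⁻¹ − 1| < O(1)B₃exp(−δLM₂R₁)ε₁` itself — it enters as the
hypothesis `hW`; it is DERIVED in this row's members `B14Eq119From190` (p264616), `B14From190SupSize`/`LayerSizes`/`SectG`
(p266115/p269225/p305926) and `B14From190ConcreteC` (p357215) from [Balaban1985Variational] (190) in p29's lattice model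
under the located leaves recorded there; the geometric sentences («□′^{∼4} is contained in Ω₁», determination by `V` on
`□′^{∼3}` — cube geometry, parameters here as in rows B14.Eq1.8/B14.Def§1.scales); existence/uniqueness of `U₁(Ω₁, V)`
((1.12), [15] Thm 1 — `U₁` is a parameter, its defining membership is `B14.Eq112Variational.argmin112`); that print's
`exp ig₀A(b)` lies in `G` (the lift `e` with `ρ ∘ e = exp ig₀A` is a hypothesis of the provenance theorem only); anything of
(1.14)–(1.17).  Value = kernel certificate that the printed first-step bookkeeping (1.18)–(1.19) is the tree's (3.16)/(1.8)
calculus at `k = 0` with the «equal to 1 / omit / remain only» sentences proved, NOT summit progress.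

## References
* [Balaban1988Convergent] T. Bałaban, Commun. Math. Phys. 119 (1988) 243–285, (1.18)–(1.19) p. 250; (1.8)–(1.9) p. 247,
  (1.12)–(1.13) p. 248, (1.25) p. 252, (3.3) p. 265, (3.16) p. 268.
* [Balaban1985Averaging] T. Bałaban, Commun. Math. Phys. 98 (1985) 17–51, (19) p. 21 (operator norm `|U − 1|`), (24)
  (`|e^{ix} − 1| ≤ |x|`, the tree's `MatrixLog.norm_expUnitary_sub_one_le`).
* [Balaban1985Variational] T. Bałaban, Commun. Math. Phys. 102 (1985) 277–309, Thm 1 p. 279, (190) p. 308 ([15]).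
-/

noncomputable section

namespace Literature.MathematicalPhysics.QuantumFieldTheory.Balaban1983to89.B14.Eq118Concrete

open Literature.MathematicalPhysics.QuantumFieldTheory.Balaban1983to89
open B15DeterminingSets B14.Sect3Decomp B14.Eq216Concrete B14.Eq316 B14.Eq119SecondFunction
open scoped BigOperators

/-! ## §1  (1.18): the fluctuation-field decomposition of unity of the first step = (3.16) at `k = 0` -/

section Eq118

variable {P : Params} {G : Type*} [GaugeGroup G] {𝔸 : Type*} [SeminormedAddCommGroup 𝔸]

/-- The cube condition of (1.18)/(1.19)₁, verbatim: `sup_{b∈(□′^{∼2})*} |A(b)| < g₀⁻¹δ₀`, i.e. r11's (3.16) condition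
`B14.Eq316.SmallFluct` on the first-step data (`D.bondsStar □′ = (□′^{∼2})*` of (1.9), threshold `g₀⁻¹δ₀`).
[cite: Balaban1988Convergent, (1.18) p.250] -/
theorem smallFluct_first_iff (D : Sect3Data P G 0) (g₀ δ₀ : ℝ) (A : PBond P 0 → 𝔸) (c : D.Cube1) :
    SmallFluct D.bondsStar A (g₀⁻¹ * δ₀) c ↔ ∀ b ∈ D.bondsStar c, ‖A b‖ < g₀⁻¹ * δ₀ :=
  Iff.rfl

/-- **(1.18)** p. 250 [PDF 8], PROVED for the concrete χ^{(0)}, χ^{(0)c}: `Σ_{R₁⊂Ω₁^{∼−1}} χ^{(0)}(R₁ᶜ)(A) χ^{(0)c}(R₁)(A) = 1`,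
the sum over all sub-families `R₁` of the family `inner` of L²M₂R₁-cubes of `Ω₁^{∼−1}` («R₁ᶜ means the complement to
Ω₁^{∼−1}»: `inner ∖ R₁`), `χ^{(0)}(X)(A) = Π_{□′∈X} χ({sup_{b∈(□′^{∼2})*}|A(b)| < g₀⁻¹δ₀})` = `chiK D.bondsStar A (g₀⁻¹δ₀) X`
and `χ^{(0)c}` = `chiKc …` — (1.18) IS (3.16) at the first step: r11's `B14.Eq316.eq316`, by name.
[cite: Balaban1988Convergent, (1.18) p.250] -/
theorem eq118_concrete (D : Sect3Data P G 0) (g₀ δ₀ : ℝ) (A : PBond P 0 → 𝔸) (inner : Finset D.Cube1) :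
    ∑ R1 ∈ inner.powerset,
      chiK D.bondsStar A (g₀⁻¹ * δ₀) (inner \ R1) * chiKc D.bondsStar A (g₀⁻¹ * δ₀) R1 = 1 :=
  eq316 D.bondsStar A (g₀⁻¹ * δ₀) inner

/-- In (1.18) exactly one term is non-zero at a given fluctuation field: the one whose `R₁` is THE family of large
fluctuation-field cubes `{□′ ⊂ Ω₁^{∼−1} : ¬ sup_{(□′^{∼2})*}|A| < g₀⁻¹δ₀}` (so `Σ_{R₁}` selects the large-field region of
p. 251's (1.20)). [cite: Balaban1988Convergent, (1.18) p.250] -/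
theorem eq118_term_eq_one_iff (D : Sect3Data P G 0) (g₀ δ₀ : ℝ) (A : PBond P 0 → 𝔸) (inner R1 : Finset D.Cube1)
    (hR : R1 ⊆ inner) :
    chiK D.bondsStar A (g₀⁻¹ * δ₀) (inner \ R1) * chiKc D.bondsStar A (g₀⁻¹ * δ₀) R1 = 1 ↔
      R1 = inner.filter fun c => ¬ SmallFluct D.bondsStar A (g₀⁻¹ * δ₀) c :=
  eq316_term_eq_one_iff D.bondsStar A (g₀⁻¹ * δ₀) inner R1 hR

/-- The first function of (1.19) is `χ^{(0)}` of the one-cube family `{□′}`: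
`χ^{(0)}({□′})(A) = χ({sup_{b∈(□′^{∼2})*}|A(b)| < g₀⁻¹δ₀})`. [cite: Balaban1988Convergent, (1.19) p.250] -/
theorem chiK_singleton (D : Sect3Data P G 0) (g₀ δ₀ : ℝ) (A : PBond P 0 → 𝔸) (c : D.Cube1) :
    chiK D.bondsStar A (g₀⁻¹ * δ₀) {c} = if SmallFluct D.bondsStar A (g₀⁻¹ * δ₀) c then (1 : ℝ) else 0 := by
  unfold chiK
  rw [Finset.prod_singleton]

/-- `χ^{(0)}(X) = Π_{□′∈X} χ^{(0)}({□′})` — the printed product form of (1.18)'s first factor, cube by cube.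
[cite: Balaban1988Convergent, (1.18) p.250] -/
theorem chiK_eq_prod_singleton (D : Sect3Data P G 0) (g₀ δ₀ : ℝ) (A : PBond P 0 → 𝔸) (X : Finset D.Cube1) :
    chiK D.bondsStar A (g₀⁻¹ * δ₀) X = ∏ c ∈ X, chiK D.bondsStar A (g₀⁻¹ * δ₀) {c} := by
  simp only [chiK_singleton]
  rfl

end Eq118

/-! ## §2  (1.19): the product of the two characteristic functions, and «the second function … is equal to 1» -/

section Eq119

open selfAdjoint

variable {P : Params} {G : Type*} [GaugeGroup G] {𝔸 : Type*} [CStarAlgebra 𝔸]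

/-- The support of (1.19)₁ in scaled form: for `g₀ > 0`, `sup_{(□′^{∼2})*}|A(b)| < g₀⁻¹δ₀` iff `‖g₀A(b)‖ < δ₀` for every
starred bond — the hypothesis under which gen 3's bondwise estimate `‖e^{ig₀A(b)} − 1‖ ≤ ‖g₀A(b)‖ < δ₀` applies.
[cite: Balaban1988Convergent, (1.19) p.250] -/
theorem smallFluct_first_iff_scaled (D : Sect3Data P G 0) {g₀ : ℝ} (hg₀ : 0 < g₀) (δ₀ : ℝ)
    (A : PBond P 0 → selfAdjoint 𝔸) (c : D.Cube1) :
    SmallFluct D.bondsStar (fun b => (A b : 𝔸)) (g₀⁻¹ * δ₀) c ↔ ∀ b ∈ D.bondsStar c, ‖g₀ • A b‖ < δ₀ := by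
  refine forall₂_congr fun b _ => ?_
  have hn : ‖g₀ • A b‖ = g₀ * ‖(A b : 𝔸)‖ := by
    change ‖((g₀ • A b : selfAdjoint 𝔸) : 𝔸)‖ = g₀ * ‖(A b : 𝔸)‖
    rw [val_smul, norm_smul, Real.norm_eq_abs, abs_of_pos hg₀]
  rw [hn, ← div_eq_inv_mul, lt_div_iff₀ hg₀, mul_comm]

/-- **PROVENANCE of (1.19)₂** («For this cube we now have the product of the two characteristic functions»): the second
function of (1.19), `χ({sup_{b∈(□′^{∼2})*}|exp ig₀A(b) U₁(b)U_{1,□′}⁻¹(b) − 1| < 2δ₀})`, IS the (1.8)-function `χ₀′` of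
the cube `□′` — gen 2's `B14.Sect3Decomp.chiPrime D av (2δ₀) {□′}` at `k = 0`, where `V^{(0)}_{□′} = M⁰(U_{1,□′}) = U_{1,□′}`
((3.4), `B14.Eq18Concrete.vbox_zero`) — evaluated at the translated field `U(b) = e(b)U₁(b)` (p. 248 «we make the translation
U = U′U₁», (1.13) `U′ = exp iA′`, the scaling of p. 249), for any `G`-valued lift `e` of `exp ig₀A` through the realisation
`ρ` (`ρ(e(b)) = exp ig₀A(b)`: print's `A` is 𝐠-valued) and the operator-norm reading `‖ρ g − 1‖ = |g − 1|` of `dist1`.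
[cite: Balaban1988Convergent, (1.19) p.250] -/
theorem second119_eq_chiPrime (D : Sect3Data P G 0) (av : ∀ j, Averaging P j G) (ρ : G →* 𝔸)
    (hρ : ∀ g : G, ‖ρ g - 1‖ = dist1 g) (g₀ δ₀ : ℝ) (A : PBond P 0 → selfAdjoint 𝔸) (e : PBond P 0 → G)
    (he : ∀ b, ρ (e b) = (expUnitary (g₀ • A b) : 𝔸)) (U₁ : GaugeField P 0 G) (V : GaugeField P 1 G) (c : D.Cube1) :
    secondFunction (D.bondsStar c) (fun b => (expUnitary (g₀ • A b) : 𝔸) * ρ (U₁ b * (D.UkLoc c V b)⁻¹)) δ₀ =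
      chiPrime D av (2 * δ₀) {c} (fun b => e b * U₁ b) V := by
  unfold secondFunction chiPrime SmallApproxFluct Vbox
  rw [Finset.prod_singleton]
  have hb : ∀ b : PBond P 0, ‖(expUnitary (g₀ • A b) : 𝔸) * ρ (U₁ b * (D.UkLoc c V b)⁻¹) - 1‖ =
      dist1 (e b * U₁ b * (Averaging.iter av 0 (D.UkLoc c V) b)⁻¹) := by
    intro b
    rw [← he b, ← map_mul, hρ, mul_assoc]
    rfl
  simp only [hb]
  congr 1

/-- **«Thus the second function in the product (1.19) is equal to 1»** p. 250, for the concrete functions: on the support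
of the first function of (1.19) (`sup_{b∈(□′^{∼2})*}|A(b)| < g₀⁻¹δ₀`, `g₀ > 0`) and under print's bound on the starred bonds
in the located form `‖ρ(U₁(b)U_{1,□′}(V)(b)⁻¹) − 1‖ ≤ ε` with `ε ≤ δ₀/2` («the bound can be made much smaller than δ₀»;
threshold `B14.Eq119SecondFunction.small_if_M2R1_large`) and `δ₀ ≤ 1`, the second function equals `1` — gen 3's
`secondFunction_eq_one` (bondwise `‖e^{ig₀A(b)}W − 1‖ < 2δ₀`, [Balaban1985Averaging] (24)) with `x(b) := g₀A(b)`.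
[cite: Balaban1988Convergent, (1.19) p.250] -/
theorem second119_eq_one (D : Sect3Data P G 0) (ρ : G →* 𝔸) {g₀ δ₀ ε : ℝ} (hg₀ : 0 < g₀)
    (A : PBond P 0 → selfAdjoint 𝔸) (U₁ : GaugeField P 0 G) (V : GaugeField P 1 G) (c : D.Cube1)
    (hsmall : SmallFluct D.bondsStar (fun b => (A b : 𝔸)) (g₀⁻¹ * δ₀) c)
    (hW : ∀ b ∈ D.bondsStar c, ‖ρ (U₁ b * (D.UkLoc c V b)⁻¹) - 1‖ ≤ ε) (hε : ε ≤ δ₀ / 2) (hδ₀ : δ₀ ≤ 1) :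
    secondFunction (D.bondsStar c) (fun b => (expUnitary (g₀ • A b) : 𝔸) * ρ (U₁ b * (D.UkLoc c V b)⁻¹)) δ₀ = 1 :=
  secondFunction_eq_one (D.bondsStar c) (fun b => g₀ • A b) (fun b => ρ (U₁ b * (D.UkLoc c V b)⁻¹))
    ((smallFluct_first_iff_scaled D hg₀ δ₀ A c).1 hsmall) hW hε hδ₀

/-- The same with print's bound stated on the group: `|U₁(b)U_{1,□′}(V)(b)⁻¹ − 1| ≤ ε` for `dist1 = |· − 1|` and the
operator-norm realisation `‖ρ g − 1‖ = dist1 g` (the DEFINITION of `dist1` for the tree's matrix groups,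
`GaugeGroup.ofUnitaryRep_dist1`). [cite: Balaban1988Convergent, (1.19) p.250] -/
theorem second119_eq_one_of_dist1 (D : Sect3Data P G 0) (ρ : G →* 𝔸) (hρ : ∀ g : G, ‖ρ g - 1‖ = dist1 g)
    {g₀ δ₀ ε : ℝ} (hg₀ : 0 < g₀) (A : PBond P 0 → selfAdjoint 𝔸) (U₁ : GaugeField P 0 G) (V : GaugeField P 1 G)
    (c : D.Cube1) (hsmall : SmallFluct D.bondsStar (fun b => (A b : 𝔸)) (g₀⁻¹ * δ₀) c)
    (hW : ∀ b ∈ D.bondsStar c, dist1 (U₁ b * (D.UkLoc c V b)⁻¹) ≤ ε) (hε : ε ≤ δ₀ / 2) (hδ₀ : δ₀ ≤ 1) :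
    secondFunction (D.bondsStar c) (fun b => (expUnitary (g₀ • A b) : 𝔸) * ρ (U₁ b * (D.UkLoc c V b)⁻¹)) δ₀ = 1 :=
  second119_eq_one D ρ hg₀ A U₁ V c hsmall (fun b hb => (hρ _).le.trans (hW b hb)) hε hδ₀

/-- **«… and we can omit it»** p. 250: the product (1.19) equals its first factor,
`χ({sup|A| < g₀⁻¹δ₀}) · χ({sup|exp ig₀A U₁U_{1,□′}⁻¹ − 1| < 2δ₀}) = χ({sup|A| < g₀⁻¹δ₀})`, under print's bound on the
starred bonds of `□′` (no support hypothesis: off the support of the first function both sides vanish).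
[cite: Balaban1988Convergent, (1.19) p.250] -/
theorem prod119_eq_first (D : Sect3Data P G 0) (ρ : G →* 𝔸) {g₀ δ₀ ε : ℝ} (hg₀ : 0 < g₀)
    (A : PBond P 0 → selfAdjoint 𝔸) (U₁ : GaugeField P 0 G) (V : GaugeField P 1 G) (c : D.Cube1)
    (hW : ∀ b ∈ D.bondsStar c, ‖ρ (U₁ b * (D.UkLoc c V b)⁻¹) - 1‖ ≤ ε) (hε : ε ≤ δ₀ / 2) (hδ₀ : δ₀ ≤ 1) :
    chiK D.bondsStar (fun b => (A b : 𝔸)) (g₀⁻¹ * δ₀) {c} *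
        secondFunction (D.bondsStar c) (fun b => (expUnitary (g₀ • A b) : 𝔸) * ρ (U₁ b * (D.UkLoc c V b)⁻¹)) δ₀ =
      chiK D.bondsStar (fun b => (A b : 𝔸)) (g₀⁻¹ * δ₀) {c} := by
  rw [chiK_singleton]
  by_cases hsmall : SmallFluct D.bondsStar (fun b => (A b : 𝔸)) (g₀⁻¹ * δ₀) c
  · rw [if_pos hsmall, second119_eq_one D ρ hg₀ A U₁ V c hsmall hW hε hδ₀, one_mul]
  · rw [if_neg hsmall, zero_mul]

/-- **AT PRINT'S INSTANCE**: on r11's first-step instance `B14.Eq216Concrete.sect3Of bg M₁ D enl4` — whose localized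
background `U_{1,□′}(V)` IS the concrete (1.2) = (2.16) at scale 1, `ukBox bg M₁ (□′^{∼4}) 1 V`, the instance on which
(1.8) is `B14.Eq18Concrete.eq18_concrete` — the second function of (1.19) reads
`χ({sup_{(□′^{∼2})*}|exp ig₀A(b) U₁(b) (ukBox bg M₁ (□′^{∼4}) 1 V)(b)⁻¹ − 1| < 2δ₀})` and equals `1` on the support of the
first function under print's bound. [cite: Balaban1988Convergent, (1.19) p.250, (1.2) p.246] -/
theorem second119_eq_one_concrete {av : ∀ j, Averaging P j G} (bg : DetBackground P G av) (M₁ : ℕ)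
    (D : Sect3Data P G 0) (enl4 : D.Cube1 → Set (Site P 0)) (ρ : G →* 𝔸) (hρ : ∀ g : G, ‖ρ g - 1‖ = dist1 g)
    {g₀ δ₀ ε : ℝ} (hg₀ : 0 < g₀) (A : PBond P 0 → selfAdjoint 𝔸) (U₁ : GaugeField P 0 G) (V : GaugeField P 1 G)
    (c : D.Cube1) (hsmall : SmallFluct D.bondsStar (fun b => (A b : 𝔸)) (g₀⁻¹ * δ₀) c)
    (hW : ∀ b ∈ D.bondsStar c, dist1 (U₁ b * (ukBox bg M₁ (enl4 c) 1 V b)⁻¹) ≤ ε) (hε : ε ≤ δ₀ / 2) (hδ₀ : δ₀ ≤ 1) :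
    secondFunction ((sect3Of bg M₁ D enl4).bondsStar c)
        (fun b => (expUnitary (g₀ • A b) : 𝔸) * ρ (U₁ b * ((sect3Of bg M₁ D enl4).UkLoc c V b)⁻¹)) δ₀ = 1 :=
  second119_eq_one_of_dist1 (sect3Of bg M₁ D enl4) ρ hρ hg₀ A U₁ V c hsmall hW hε hδ₀

/-! ## §3  «These functions remain only for □′ ⊂ (Ω₁∖Ω₁^{∼−1}) ∪ R₁ …» -/

/-- **«These functions remain only for □′ ⊂ (Ω₁∖Ω₁^{∼−1}) ∪ R₁, more precisely they are the only functions for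
□′ ⊂ Ω₁∖Ω₁^{∼−1}, and for □′ ⊂ R₁ they are multiplied by the corresponding large field characteristic function in
(1.18)»** p. 250, PROVED as the bookkeeping identity it states: for the cube families `inner ⊆ omega` of `Ω₁^{∼−1} ⊆ Ω₁`
and the second functions `S(□′)` of (1.19) carried by the cubes of `Ω₁` (p. 248), inserting the decomposition of unity (1.18)
(a function of `A` only) and omitting `S` on every `R₁ᶜ` (§2):
`Π_{□′∈omega} S(□′) = Σ_{R₁⊆inner} χ^{(0)}(inner∖R₁) · χ^{(0)c}(R₁) · (Π_{□′∈R₁} S(□′)) · (Π_{□′∈omega∖inner} S(□′))`.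
(The further split of `χ^{(0)}(R₁ᶜ)` along `Λ₁` is (1.25) p. 252, row B14.Eq1.23–1.25.) [cite: Balaban1988Convergent, (1.18)–(1.19) p.250] -/
theorem eq119_remaining (D : Sect3Data P G 0) (ρ : G →* 𝔸) {g₀ δ₀ ε : ℝ} (hg₀ : 0 < g₀)
    (A : PBond P 0 → selfAdjoint 𝔸) (U₁ : GaugeField P 0 G) (V : GaugeField P 1 G) {inner omega : Finset D.Cube1}
    (hsub : inner ⊆ omega)
    (hW : ∀ c ∈ inner, ∀ b ∈ D.bondsStar c, ‖ρ (U₁ b * (D.UkLoc c V b)⁻¹) - 1‖ ≤ ε) (hε : ε ≤ δ₀ / 2) (hδ₀ : δ₀ ≤ 1) :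
    (∏ c ∈ omega,
        secondFunction (D.bondsStar c) (fun b => (expUnitary (g₀ • A b) : 𝔸) * ρ (U₁ b * (D.UkLoc c V b)⁻¹)) δ₀) =
      ∑ R1 ∈ inner.powerset,
        chiK D.bondsStar (fun b => (A b : 𝔸)) (g₀⁻¹ * δ₀) (inner \ R1) *
          chiKc D.bondsStar (fun b => (A b : 𝔸)) (g₀⁻¹ * δ₀) R1 *
          ((∏ c ∈ R1, secondFunction (D.bondsStar c)
              (fun b => (expUnitary (g₀ • A b) : 𝔸) * ρ (U₁ b * (D.UkLoc c V b)⁻¹)) δ₀) *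
            ∏ c ∈ omega \ inner, secondFunction (D.bondsStar c)
              (fun b => (expUnitary (g₀ • A b) : 𝔸) * ρ (U₁ b * (D.UkLoc c V b)⁻¹)) δ₀) := by
  classical
  -- abbreviations (local to the proof)
  set S : D.Cube1 → ℝ := fun c => secondFunction (D.bondsStar c)
    (fun b => (expUnitary (g₀ • A b) : 𝔸) * ρ (U₁ b * (D.UkLoc c V b)⁻¹)) δ₀ with hS
  set thr : ℝ := g₀⁻¹ * δ₀ with hthr
  set A' : PBond P 0 → 𝔸 := fun b => (A b : 𝔸) with hA'
  -- «we can omit it» on every sub-family of `inner`: χ^{(0)}(X) · Π_{X} S = χ^{(0)}(X)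
  have homit : ∀ X : Finset D.Cube1, X ⊆ inner → chiK D.bondsStar A' thr X * ∏ c ∈ X, S c = chiK D.bondsStar A' thr X := by
    intro X hX
    rw [chiK_eq_prod_singleton, ← Finset.prod_mul_distrib]
    refine Finset.prod_congr rfl fun c hc => ?_
    exact prod119_eq_first D ρ hg₀ A U₁ V c (hW c (hX hc)) hε hδ₀
  -- split the product over `omega` along `inner` and `R1`
  have hsplit : ∀ R1 ∈ inner.powerset,
      ∏ c ∈ omega, S c = (∏ c ∈ inner \ R1, S c) * ((∏ c ∈ R1, S c) * ∏ c ∈ omega \ inner, S c) := by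
    intro R1 hR1
    rw [Finset.mem_powerset] at hR1
    rw [← Finset.prod_sdiff hsub, mul_comm (∏ c ∈ omega \ inner, S c), ← Finset.prod_sdiff hR1, mul_assoc]
  -- insert (1.18) = 1 and distribute
  calc ∏ c ∈ omega, S c
      = (∑ R1 ∈ inner.powerset, chiK D.bondsStar A' thr (inner \ R1) * chiKc D.bondsStar A' thr R1) *
          ∏ c ∈ omega, S c := by rw [eq118_concrete D g₀ δ₀ A' inner, one_mul]
    _ = ∑ R1 ∈ inner.powerset, chiK D.bondsStar A' thr (inner \ R1) * chiKc D.bondsStar A' thr R1 *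
          ∏ c ∈ omega, S c := Finset.sum_mul _ _ _
    _ = ∑ R1 ∈ inner.powerset, chiK D.bondsStar A' thr (inner \ R1) * chiKc D.bondsStar A' thr R1 *
          ((∏ c ∈ R1, S c) * ∏ c ∈ omega \ inner, S c) := by
        refine Finset.sum_congr rfl fun R1 hR1 => ?_
        rw [hsplit R1 hR1, ← mul_assoc]
        congr 1
        rw [mul_right_comm, homit (inner \ R1) Finset.sdiff_subset]

end Eq119

/-! ## §4  Print's instance `G = U(n) ⊂ M_n(ℂ)`: the realisation hypotheses discharged -/

section UnitaryGroup

open selfAdjoint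
open scoped Matrix.Norms.L2Operator

variable {P : Params} (n : Type) [Fintype n] [DecidableEq n] [Nonempty n]

/-- **Print's instance of the realisation**: for `G = U(n) ⊂ M_n(ℂ)` with the operator norm (the tree's `UnitaryModel`
instance, [Balaban1985Averaging] (19) `|U − 1|`), the inclusion `ρ : U(n) →* M_n(ℂ)` satisfies `‖ρU − 1‖ = dist1 U`
(definitionally), and `e(b) := exp ig₀A(b) ∈ U(n)` lifts `exp ig₀A` through `ρ` (definitionally) — the hypotheses `hρ`, `he`
of §2 hold at print's instance. [cite: Balaban1988Convergent, (1.19) p.250] -/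
theorem realisation_unitaryGroup :
    letI : CStarAlgebra (Matrix n n ℂ) := CStarAlgebra.mk
    (∀ U : Matrix.unitaryGroup n ℂ, ‖(Matrix.unitaryGroup n ℂ).subtype U - 1‖ = dist1 U) ∧
    ∀ (g₀ : ℝ) (A : PBond P 0 → selfAdjoint (Matrix n n ℂ)) (b : PBond P 0),
      (Matrix.unitaryGroup n ℂ).subtype (expUnitary (g₀ • A b)) = (expUnitary (g₀ • A b) : Matrix n n ℂ) :=
  ⟨fun _ => rfl, fun _ _ _ => rfl⟩

/-- **(1.19)₂ at print's instance `G = U(n)`, NO realisation hypothesis**: the second function of (1.19),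
`χ({sup_{b∈(□′^{∼2})*}|exp ig₀A(b) U₁(b)U_{1,□′}⁻¹(b) − 1| < 2δ₀})` with `|·|` the operator norm on `M_n(ℂ)`, IS the
(1.8)-function `χ₀′` of `□′` (gen 2's `chiPrime D av (2δ₀) {□′}` at `k = 0`) at the translated field `U(b) = e^{ig₀A(b)}U₁(b) ∈
U(n)` (p. 248 «U = U′U₁», (1.13) «U′ = exp iA′»). [cite: Balaban1988Convergent, (1.19) p.250, (1.8) p.247] -/
theorem second119_eq_chiPrime_unitaryGroup (D : Sect3Data P (Matrix.unitaryGroup n ℂ) 0)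
    (av : ∀ j, Averaging P j (Matrix.unitaryGroup n ℂ)) (g₀ δ₀ : ℝ) :
    letI : CStarAlgebra (Matrix n n ℂ) := CStarAlgebra.mk
    ∀ (A : PBond P 0 → selfAdjoint (Matrix n n ℂ)) (U₁ : GaugeField P 0 (Matrix.unitaryGroup n ℂ))
      (V : GaugeField P 1 (Matrix.unitaryGroup n ℂ)) (c : D.Cube1),
      secondFunction (D.bondsStar c)
          (fun b => (expUnitary (g₀ • A b) : Matrix n n ℂ) *
            ((U₁ b * (D.UkLoc c V b)⁻¹ : Matrix.unitaryGroup n ℂ) : Matrix n n ℂ)) δ₀ =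
        chiPrime D av (2 * δ₀) {c} (fun b => expUnitary (g₀ • A b) * U₁ b) V := by
  intro A U₁ V c
  letI : CStarAlgebra (Matrix n n ℂ) := CStarAlgebra.mk
  unfold secondFunction chiPrime SmallApproxFluct Vbox
  rw [Finset.prod_singleton]
  have hb : ∀ b : PBond P 0, ‖(expUnitary (g₀ • A b) : Matrix n n ℂ) *
      ((U₁ b * (D.UkLoc c V b)⁻¹ : Matrix.unitaryGroup n ℂ) : Matrix n n ℂ) - 1‖ =
      dist1 (expUnitary (g₀ • A b) * U₁ b * (Averaging.iter av 0 (D.UkLoc c V) b)⁻¹) := by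
    intro b
    rw [mul_assoc]
    rfl
  simp only [hb]
  congr 1

/-- **«the second function in the product (1.19) is equal to 1» at print's instance `G = U(n)`**: on the support of the
first function (`g₀ > 0`) and under print's bound `|U₁(b)U_{1,□′}(V)(b)⁻¹ − 1| ≤ ε ≤ δ₀/2`, `δ₀ ≤ 1` (operator norm), with
no realisation hypothesis left. [cite: Balaban1988Convergent, (1.19) p.250] -/
theorem second119_eq_one_unitaryGroup (D : Sect3Data P (Matrix.unitaryGroup n ℂ) 0) {g₀ δ₀ ε : ℝ} (hg₀ : 0 < g₀)
    (hε : ε ≤ δ₀ / 2) (hδ₀ : δ₀ ≤ 1) :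
    letI : CStarAlgebra (Matrix n n ℂ) := CStarAlgebra.mk
    ∀ (A : PBond P 0 → selfAdjoint (Matrix n n ℂ)) (U₁ : GaugeField P 0 (Matrix.unitaryGroup n ℂ))
      (V : GaugeField P 1 (Matrix.unitaryGroup n ℂ)) (c : D.Cube1),
      SmallFluct D.bondsStar (fun b => (A b : Matrix n n ℂ)) (g₀⁻¹ * δ₀) c →
      (∀ b ∈ D.bondsStar c, dist1 (U₁ b * (D.UkLoc c V b)⁻¹) ≤ ε) →
      secondFunction (D.bondsStar c)
          (fun b => (expUnitary (g₀ • A b) : Matrix n n ℂ) *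
            ((U₁ b * (D.UkLoc c V b)⁻¹ : Matrix.unitaryGroup n ℂ) : Matrix n n ℂ)) δ₀ = 1 := by
  intro A U₁ V c hsmall hW
  letI : CStarAlgebra (Matrix n n ℂ) := CStarAlgebra.mk
  exact second119_eq_one_of_dist1 D (Matrix.unitaryGroup n ℂ).subtype (fun _ => rfl) hg₀ A U₁ V c hsmall hW hε hδ₀

end UnitaryGroup

end Literature.MathematicalPhysics.QuantumFieldTheory.Balaban1983to89.B14.Eq118Concrete
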